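import Mathlib.Tactic
import HarnessLib
import HarnessLib.Audit.Tags
import Summits.CriticalPhenomena.PercolationContinuityZ3.Theorems.PercNearOneGluingNoHeavyLowerTailSahiAntichainSixPrep
import Summits.CriticalPhenomena.PercolationContinuityZ3.Theorems.PercNearOneGluingNoHeavyLowerTailSahiAntichainDual

/-!
# Antichains, meets plus joins: erasing a member, and `f ≥ 9 + #meets(above)` at every `3 + 3` point

Support file (seat `prim-masterthm-p1`, gen 38; `--supports stmt-CriticalPhenomena-4575`).  No `sorry`, no new definitions, standard
axioms.  Memo `run/shared/lean/prim/prim-masterthm/FROM-prim-masterthm-p1-g38-BLOWUP-SIDE.md` §4.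

SETTING (files `…SahiAntichainSplit*`): `f P = #meets P + #joins P`; at a point `r`, `f P = f (above P r) + f (below P r) + newLabels P r`.
H23 (`eight_le_of_two_three`, `…TwoThreeA`): at a `2 + 3` point, `f (below) + newLabels ≥ 8`.

NEW HERE ([this work], gen 38).
* **Erasing a member containing `r` does not create new meets and creates at most the lost old joins as new joins**:
  `newMeets (P.erase g) r ⊆ newMeets P r` and `newJoins (P.erase g) r ⊆ newJoins P r ∪ (joins (above P r) \\ joins ((above P r).erase g))`,
  hence `newLabels (P.erase g) r ≤ newLabels P r + #(joins (above P r) \\ joins ((above P r).erase g))` (`newLabels_erase_le`).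
* **`9 + #meets (above P r) ≤ f P` at every `3 + 3` point of an antichain** (`nine_add_card_meets_le`): erase one of the three members
  above (exactly `#joins (above) − 1` old joins are lost, the remaining pair having one join) and apply H23 to the `2 + 3` point that
  remains.  Dually `9 + #joins (below P r) ≤ f P` (`nine_add_card_joins_le`, by complementation).
So a six-member antichain with `f ≤ 11` has, at every effective point, at most two meets above and at most two joins below — the
first step of the structure theorem (companion file `…SixShape`).
HONEST FRAMING: unconditional lemmas. [this work]
-/

namespace Summit.CriticalPhenomena.PercolationContinuityZ3.Theorems.SahiColouredDaykin

open Finset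

variable {α : Type*} [DecidableEq α]

/-! ### 1. Erasing a member containing `r` -/

section Erase

variable {P : Finset (Finset α)} {r : α} {g : Finset α}

/-- `above` commutes with `erase`. [this work] -/
theorem above_erase (P : Finset (Finset α)) (r : α) (g : Finset α) : above (P.erase g) r = (above P r).erase g := by
  unfold above; exact filter_erase _ _ _

/-- Erasing a member containing `r` does not change `below`. [this work] -/
theorem below_erase_of_mem (P : Finset (Finset α)) (hrg : r ∈ g) : below (P.erase g) r = below P r := by
  unfold below
  rw [filter_erase]
  exact erase_eq_of_notMem fun h => (mem_filter.1 h).2 hrg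

/-- Cross meets of `P.erase g` are cross meets of `P`. [this work] -/
theorem crossMeets_erase_subset (P : Finset (Finset α)) (r : α) (g : Finset α) : crossMeets (P.erase g) r ⊆ crossMeets P r := by
  intro Z hZ
  obtain ⟨a, ha, b, hb, hra, hrb, rfl⟩ := mem_crossMeets_iff.1 hZ
  exact mem_crossMeets_iff.2 ⟨a, mem_of_mem_erase ha, b, mem_of_mem_erase hb, hra, hrb, rfl⟩

/-- Cross joins of `P.erase g` are cross joins of `P`. [this work] -/
theorem crossJoins_erase_subset (P : Finset (Finset α)) (r : α) (g : Finset α) : crossJoins (P.erase g) r ⊆ crossJoins P r := by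
  intro W hW
  obtain ⟨a, ha, b, hb, hra, hrb, rfl⟩ := mem_crossJoins_iff.1 hW
  exact mem_crossJoins_iff.2 ⟨a, mem_of_mem_erase ha, b, mem_of_mem_erase hb, hra, hrb, rfl⟩

/-- **Erasing a member containing `r` creates no new meets.** [this work] -/
theorem newMeets_erase_subset (P : Finset (Finset α)) (hrg : r ∈ g) : newMeets (P.erase g) r ⊆ newMeets P r := by
  intro Z hZ
  unfold newMeets at hZ ⊢
  rw [mem_sdiff] at hZ ⊢
  rw [below_erase_of_mem P hrg] at hZ
  exact ⟨crossMeets_erase_subset P r g hZ.1, hZ.2⟩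

/-- **Erasing a member containing `r` creates as new joins at most the lost old joins.** [this work] -/
theorem newJoins_erase_subset (P : Finset (Finset α)) (r : α) (g : Finset α) :
    newJoins (P.erase g) r ⊆ newJoins P r ∪ (joins (above P r) \ joins ((above P r).erase g)) := by
  intro W hW
  unfold newJoins at hW ⊢
  rw [mem_sdiff, above_erase] at hW
  rw [mem_union, mem_sdiff, mem_sdiff]
  by_cases hold : W ∈ joins (above P r)
  · exact Or.inr ⟨hold, hW.2⟩
  · exact Or.inl ⟨crossJoins_erase_subset P r g hW.1, hold⟩

/-- **The erase inequality**: `newLabels (P.erase g) r ≤ newLabels P r + #(lost old joins)` for `r ∈ g`. [this work] -/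
theorem newLabels_erase_le (P : Finset (Finset α)) (hrg : r ∈ g) :
    newLabels (P.erase g) r ≤ newLabels P r + #(joins (above P r) \ joins ((above P r).erase g)) := by
  unfold newLabels
  have h1 := card_le_card (newMeets_erase_subset P hrg)
  have h2 := (card_le_card (newJoins_erase_subset P r g)).trans (card_union_le _ _)
  omega

/-- `P.erase g` is again an antichain. [this work] -/
theorem isAntichain_erase (hanti : IsAntichain (· ⊆ ·) (P : Set (Finset α))) (g : Finset α) :
    IsAntichain (· ⊆ ·) ((P.erase g : Finset (Finset α)) : Set (Finset α)) :=
  hanti.subset fun _ hx => mem_coe.2 (mem_of_mem_erase (mem_coe.1 hx))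

end Erase

/-! ### 2. `9 + #meets(above) ≤ f` at every `3 + 3` point -/

/-- **At a `3 + 3` point of an antichain, `9 + #meets (above P r) ≤ #meets P + #joins P`.** [this work] -/
theorem nine_add_card_meets_le {P : Finset (Finset α)} {r : α} (hanti : IsAntichain (· ⊆ ·) (P : Set (Finset α)))
    (h3 : #(above P r) = 3) (h3' : #(below P r) = 3) :
    9 + #(meets (above P r)) ≤ #(meets P) + #(joins P) := by
  obtain ⟨a₁, a₂, a₃, h12, h13, h23, hA⟩ := card_eq_three.1 h3
  have ha₃ : a₃ ∈ above P r := by rw [hA]; simp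
  obtain ⟨ha₃P, hra₃⟩ := mem_above_iff.1 ha₃
  -- the erased family: a `2 + 3` point
  have hAe : (above P r).erase a₃ = {a₁, a₂} := by
    rw [hA]
    ext x
    simp only [mem_erase, mem_insert, mem_singleton]
    constructor
    · rintro ⟨hne, h | h | h⟩
      · exact Or.inl h
      · exact Or.inr h
      · exact absurd h hne
    · rintro (rfl | rfl)
      · exact ⟨h13, Or.inl rfl⟩
      · exact ⟨h23, Or.inr (Or.inl rfl)⟩
  have h2 : #(above (P.erase a₃) r) = 2 := by rw [above_erase, hAe, card_pair h12]
  have h3e : #(below (P.erase a₃) r) = 3 := by rw [below_erase_of_mem P hra₃]; exact h3'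
  have H := eight_le_of_two_three (P.erase a₃) r (isAntichain_erase hanti a₃) h2 h3e
  rw [below_erase_of_mem P hra₃] at H
  -- the lost old joins number `#joins (above) - 1`
  have hJe : joins ((above P r).erase a₃) = {a₁ ∪ a₂} := by rw [hAe, joins_pair h12]
  have hsub : joins ((above P r).erase a₃) ⊆ joins (above P r) := joins_mono (erase_subset _ _)
  have hlost := card_sdiff_add_card_eq_card hsub
  have hone : #(joins ((above P r).erase a₃)) = 1 := by rw [hJe, card_singleton]
  have hE := newLabels_erase_le P hra₃ (r := r)
  have hsplit := card_meets_add_card_joins_split P r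
  omega

/-- **Dually, `9 + #joins (below P r) ≤ #meets P + #joins P` at every `3 + 3` point** (complementation). [this work] -/
theorem nine_add_card_joins_le {P : Finset (Finset α)} {r : α} (hanti : IsAntichain (· ⊆ ·) (P : Set (Finset α)))
    (h3 : #(above P r) = 3) (h3' : #(below P r) = 3) :
    9 + #(joins (below P r)) ≤ #(meets P) + #(joins P) := by
  set F := insert r (P.sup id) with hF
  have hP : ∀ a ∈ P, a ⊆ F := subset_insert_sup P r
  have hPB : ∀ a ∈ below P r, a ⊆ F := fun a ha => hP a (below_subset P r ha)
  have hr : r ∈ F := mem_insert_self _ _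
  have H := nine_add_card_meets_le (isAntichain_image_compl hanti hP) (r := r)
    (by rw [card_above_image_compl hP hr]; exact h3') (by rw [card_below_image_compl hP hr]; exact h3)
  rw [above_image_compl (P := P) hr, card_meets_image_compl hPB, card_meets_add_card_joins_image_compl hP] at H
  exact H

/-- **Consequence for six members with at most eleven labels**: at every effective point, the three members above have at most two
meets and the three members below at most two joins. [this work] -/
theorem card_meets_above_le_two_of_six_le_eleven {P : Finset (Finset α)} {r : α} (hanti : IsAntichain (· ⊆ ·) (P : Set (Finset α)))
    (h6 : #P = 6) (hf : #(meets P) + #(joins P) ≤ 11) (hr : r ∈ effPoints P) :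
    #(meets (above P r)) ≤ 2 ∧ #(joins (below P r)) ≤ 2 := by
  obtain ⟨h3, h3'⟩ := card_above_eq_three_of_six_le_eleven hanti h6 hf hr
  have h1 := nine_add_card_meets_le hanti h3 h3'
  have h2 := nine_add_card_joins_le hanti h3 h3'
  omega

end Summit.CriticalPhenomena.PercolationContinuityZ3.Theorems.SahiColouredDaykin
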